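import Mathlib
import HarnessLib
import Summits.NavierStokesRegularity.NavierStokesRegularity.Theorems.LoopPeriodRatchetNoPlanarExtremumSard
import Summits.NavierStokesRegularity.NavierStokesRegularity.Theorems.LoopPeriodRatchetNoPlanarExtremumOrbit

/-!
# Route `LoopPeriodRatchet`, support `NoPlanarExtremum` (stmt-NavierStokesRegularity-22880) — helper III:
# a strict planar minimum of the stream function is ringed by a non-stationary closed vortex line

Support file (`--supports` the item). The topological core of `NoPlanarExtremum`, for an abstract pair
`(X, ψ)` on `ℝ³ = EuclideanSpace ℝ (Fin 3)`: `X` a `C²` HORIZONTAL field (`X₂ ≡ 0`) and `ψ ∈ C¹` a plane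
stream function of `X` (`∂₀ψ = −X₁`, `∂₁ψ = X₀`; so `Dψ(X) ≡ 0` and the in-plane critical points of `ψ` are
the zeros of `X`). **`exists_periodic_orbit_of_strict_planar_min`**: if `ψ` has a strict local minimum at
`y₀` inside the horizontal plane through `y₀`, then `y′ = X(y)` has a NON-STATIONARY PERIODIC ORBIT.

Proof. Let `ψ > ψ(y₀) = m` on the punctured planar disc of radius `r`, `r₁ = r/4`, and `μ₁ > m` the minimum of
`ψ` on the planar annulus `r₁ ≤ |y − y₀| ≤ r`. By helper I (`exists_regular_level`, the Sard substitute) some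
level `c ∈ (m, μ₁)` carries no in-plane critical point in the disc; by the intermediate value theorem it is
hit at a point `p` of the planar disc of radius `r₁`. With two bump functions `ρ` (`= 1` on `|y−y₀| ≤ r₁`,
`= 0` beyond `2r₁`) and `ρ̃` (`= 1` up to `2r₁`, `= 0` beyond `3r₁`) the pair
`H = (ρ̃(ψ − c) + (1 − ρ̃), y₂ − y₀₂)`, `V = ρ X` is a regular level-curve datum on all of `ℝ³` whose zero set
is exactly `{ψ = c} ∩ plane ∩ {|y − y₀| ≤ r₁}` (bounded, regular, containing `p`), with `dH(V) ≡ 0`; helper II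
(`exists_periodic_orbit_of_regular_level`) yields a periodic orbit of `V` through `p` inside that set, where
`V = X ≠ 0`.

Not a claim about Navier–Stokes: the D-0145 line `LoopPeriodRatchet` bears on the door rung
N0-LocalTubeDoorPoloidal (no summit, no Clay option).
-/

noncomputable section

-- the summit and its single sub-problem share the name (CONVENTIONS §1), as in every Theorems file
set_option linter.dupNamespace false

namespace Summit.NavierStokesRegularity.NavierStokesRegularity.Theorems.LoopPeriodRatchetNoPlanarExtremumCore

open Set Function Filter Topology Metric
open Summit.NavierStokesRegularity.NavierStokesRegularity.Theorems.LoopPeriodRatchetNoPlanarExtremumSard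
open Summit.NavierStokesRegularity.NavierStokesRegularity.Theorems.LoopPeriodRatchetNoPlanarExtremumOrbit

/-- `Dψ(y)[w]` in coordinates for a plane stream function: `w₀(−X₁) + w₁ X₀ + w₂ ∂₂ψ`; in particular
`Dψ(y)[X y] = 0` for a horizontal field. -/
theorem fderiv_stream_apply_self {X : EuclideanSpace ℝ (Fin 3) → EuclideanSpace ℝ (Fin 3)}
    (hX2 : ∀ y, X y 2 = 0) {ψ : EuclideanSpace ℝ (Fin 3) → ℝ}
    (hψ0 : ∀ y, fderiv ℝ ψ y (EuclideanSpace.single 0 1) = -(X y 1))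
    (hψ1 : ∀ y, fderiv ℝ ψ y (EuclideanSpace.single 1 1) = X y 0) (y : EuclideanSpace ℝ (Fin 3)) :
    fderiv ℝ ψ y (X y) = 0 := by
  rw [clm_apply_eq_sum_three, hψ0, hψ1, hX2, zero_mul, add_zero]
  ring

/-- **A strict planar minimum of the stream function is ringed by a non-stationary periodic orbit.**
`X : ℝ³ → ℝ³` of class `C²` with `X₂ ≡ 0`, `ψ ∈ C¹` with `∂₀ψ = −X₁`, `∂₁ψ = X₀`; if `ψ y₀ < ψ y` for all
`y ≠ y₀` of the horizontal plane through `y₀` near `y₀`, then `y′ = X(y)` has a periodic orbit `γ` (period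
`ℓ > 0`) with `X (γ 0) ≠ 0`. -/
theorem exists_periodic_orbit_of_strict_planar_min
    {X : EuclideanSpace ℝ (Fin 3) → EuclideanSpace ℝ (Fin 3)} (hX : ContDiff ℝ 2 X)
    (hX2 : ∀ y, X y 2 = 0) {ψ : EuclideanSpace ℝ (Fin 3) → ℝ} (hψ : ContDiff ℝ 1 ψ)
    (hψ0 : ∀ y, fderiv ℝ ψ y (EuclideanSpace.single 0 1) = -(X y 1))
    (hψ1 : ∀ y, fderiv ℝ ψ y (EuclideanSpace.single 1 1) = X y 0)
    {y₀ : EuclideanSpace ℝ (Fin 3)}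
    (hmin : ∀ᶠ y in 𝓝[{y | y 2 = y₀ 2 ∧ y ≠ y₀}] y₀, ψ y₀ < ψ y) :
    ∃ (γ : ℝ → EuclideanSpace ℝ (Fin 3)) (ℓ : ℝ), 0 < ℓ ∧ (∀ θ, HasDerivAt γ (X (γ θ)) θ) ∧
      (∀ θ, γ (θ + ℓ) = γ θ) ∧ X (γ 0) ≠ 0 := by
  have hψd : Differentiable ℝ ψ := hψ.differentiable one_ne_zero
  have hψc : Continuous ψ := hψ.continuous
  -- (a) a radius of strictness
  obtain ⟨ε, hε, hεsub⟩ := Metric.mem_nhdsWithin_iff.1 hmin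
  set r : ℝ := ε / 2 with hr
  have hr0 : 0 < r := by positivity
  have hstrict : ∀ y : EuclideanSpace ℝ (Fin 3), y 2 = y₀ 2 → y ≠ y₀ → dist y y₀ ≤ r → ψ y₀ < ψ y := by
    intro y hy2 hne hyd
    exact hεsub ⟨mem_ball.2 (by linarith), hy2, hne⟩
  -- (b) the annulus minimum `μ₁`
  set r₁ : ℝ := r / 4 with hr₁
  have hr₁0 : 0 < r₁ := by positivity
  set e0 : EuclideanSpace ℝ (Fin 3) := EuclideanSpace.single 0 1 with he0
  set e1 : EuclideanSpace ℝ (Fin 3) := EuclideanSpace.single 1 1 with he1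
  set e2 : EuclideanSpace ℝ (Fin 3) := EuclideanSpace.single 2 1 with he2
  have hne0 : ‖e0‖ = 1 := by simp [he0]
  set A : Set (EuclideanSpace ℝ (Fin 3)) := {y | y 2 = y₀ 2 ∧ r₁ ≤ dist y y₀ ∧ dist y y₀ ≤ r} with hA
  have hplane_closed : IsClosed {y : EuclideanSpace ℝ (Fin 3) | y 2 = y₀ 2} :=
    isClosed_eq (EuclideanSpace.proj (2 : Fin 3)).continuous continuous_const
  have hAclosed : IsClosed A := by
    rw [hA, Set.setOf_and, Set.setOf_and]
    exact hplane_closed.inter ((isClosed_le continuous_const (continuous_id.dist continuous_const)).inter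
      (isClosed_le (continuous_id.dist continuous_const) continuous_const))
  have hAc : IsCompact A :=
    (isCompact_closedBall y₀ r).of_isClosed_subset hAclosed (fun y hy => mem_closedBall.2 hy.2.2)
  set q₁ : EuclideanSpace ℝ (Fin 3) := y₀ + r₁ • e0 with hq₁
  have hq₁2 : q₁ 2 = y₀ 2 := by simp [hq₁, he0]
  have hq₁d : dist q₁ y₀ = r₁ := by
    rw [dist_eq_norm, hq₁, add_sub_cancel_left, norm_smul, hne0, mul_one, Real.norm_eq_abs,
      abs_of_pos hr₁0]
  have hq₁A : q₁ ∈ A := ⟨hq₁2, hq₁d.symm.le, by rw [hq₁d]; linarith⟩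
  obtain ⟨a, haA, hamin⟩ := hAc.exists_isMinOn ⟨q₁, hq₁A⟩ hψc.continuousOn
  set μ₁ : ℝ := ψ a with hμ₁
  have hμ₁m : ψ y₀ < μ₁ := by
    refine hstrict a haA.1 (fun h => ?_) haA.2.2
    have := haA.2.1; rw [h, dist_self] at this; linarith
  have hAge : ∀ y ∈ A, μ₁ ≤ ψ y := fun y hy => hamin hy
  -- (c) a regular level `c ∈ (m, μ₁)`
  obtain ⟨c, hc, hreg⟩ := exists_regular_level hX hψd hψ0 hψ1 y₀ r hμ₁m
  -- (d) a point `p` of the level in the small planar disc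
  set f : ℝ → ℝ := fun t => ψ (y₀ + t • (r₁ • e0)) with hf
  have hfc : Continuous f := hψc.comp (by fun_prop)
  have hf0 : f 0 = ψ y₀ := by simp [hf]
  have hf1 : f 1 = ψ q₁ := by simp [hf, hq₁]
  obtain ⟨t, ht, hft⟩ : c ∈ f '' Icc 0 1 :=
    intermediate_value_Icc zero_le_one hfc.continuousOn
      ⟨by rw [hf0]; exact hc.1.le, by rw [hf1]; exact hc.2.le.trans (hAge q₁ hq₁A)⟩
  set p : EuclideanSpace ℝ (Fin 3) := y₀ + t • (r₁ • e0) with hp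
  have hp2 : p 2 = y₀ 2 := by simp [hp, he0]
  have hpd : dist p y₀ ≤ r₁ := by
    rw [dist_eq_norm, hp, add_sub_cancel_left, norm_smul, norm_smul, hne0, mul_one, Real.norm_eq_abs,
      Real.norm_eq_abs, abs_of_nonneg ht.1, abs_of_pos hr₁0]
    nlinarith [ht.2]
  have hpψ : ψ p = c := hft
  -- (e) the cut-off level-curve datum
  let ρ : ContDiffBump y₀ := ⟨r₁, 2 * r₁, hr₁0, by linarith⟩
  let ρ' : ContDiffBump y₀ := ⟨2 * r₁, 3 * r₁, by positivity, by linarith⟩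
  have hρ_one : ∀ y : EuclideanSpace ℝ (Fin 3), dist y y₀ ≤ r₁ → (ρ : EuclideanSpace ℝ (Fin 3) → ℝ) y = 1 :=
    fun y hy => ρ.one_of_mem_closedBall (mem_closedBall.2 hy)
  have hρ_zero : ∀ y : EuclideanSpace ℝ (Fin 3), 2 * r₁ ≤ dist y y₀ → (ρ : EuclideanSpace ℝ (Fin 3) → ℝ) y = 0 :=
    fun y hy => ρ.zero_of_le_dist hy
  have hρ'_one : ∀ y : EuclideanSpace ℝ (Fin 3), dist y y₀ ≤ 2 * r₁ → (ρ' : EuclideanSpace ℝ (Fin 3) → ℝ) y = 1 :=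
    fun y hy => ρ'.one_of_mem_closedBall (mem_closedBall.2 hy)
  have hρ'_zero : ∀ y : EuclideanSpace ℝ (Fin 3), 3 * r₁ ≤ dist y y₀ → (ρ' : EuclideanSpace ℝ (Fin 3) → ℝ) y = 0 :=
    fun y hy => ρ'.zero_of_le_dist hy
  set H0 : EuclideanSpace ℝ (Fin 3) → ℝ := fun y => ρ' y * (ψ y - c) + (1 - ρ' y) with hH0
  set H1 : EuclideanSpace ℝ (Fin 3) → ℝ := fun y => y 2 - y₀ 2 with hH1
  set Hc : Fin 2 → EuclideanSpace ℝ (Fin 3) → ℝ := ![H0, H1] with hHc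
  set H : EuclideanSpace ℝ (Fin 3) → (Fin 2 → ℝ) := fun y i => Hc i y with hH
  set V : EuclideanSpace ℝ (Fin 3) → EuclideanSpace ℝ (Fin 3) := fun y => ρ y • X y with hV
  have hHapp0 : ∀ y, H y 0 = H0 y := fun y => rfl
  have hHapp1 : ∀ y, H y 1 = H1 y := fun y => rfl
  -- the linearised datum near the small disc
  set G0 : EuclideanSpace ℝ (Fin 3) → ℝ := fun y => ψ y - c with hG0
  set Gc : Fin 2 → EuclideanSpace ℝ (Fin 3) → ℝ := ![G0, H1] with hGc
  set G : EuclideanSpace ℝ (Fin 3) → (Fin 2 → ℝ) := fun y i => Gc i y with hG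
  have hH0c : ContDiff ℝ 1 H0 :=
    ((ρ'.contDiff (n := 1)).mul (hψ.sub contDiff_const)).add (contDiff_const.sub (ρ'.contDiff (n := 1)))
  have hc2 : ContDiff ℝ 1 (fun y : EuclideanSpace ℝ (Fin 3) => y 2) :=
    (EuclideanSpace.proj (2 : Fin 3) : EuclideanSpace ℝ (Fin 3) →L[ℝ] ℝ).contDiff
  have hH1c : ContDiff ℝ 1 H1 := hc2.sub contDiff_const
  have hG0c : ContDiff ℝ 1 G0 := hψ.sub contDiff_const
  have hHcd : ContDiff ℝ 1 H := by
    rw [hH, contDiff_pi]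
    exact Fin.forall_fin_two.2 ⟨hH0c, hH1c⟩
  have hVcd : ContDiff ℝ 1 V := (ρ.contDiff (n := 1)).smul (hX.of_le one_le_two)
  have hH1d : ∀ y w, fderiv ℝ H1 y w = w 2 := by
    intro y w
    have h : HasFDerivAt (fun y : EuclideanSpace ℝ (Fin 3) => y 2 - y₀ 2)
        (EuclideanSpace.proj (2 : Fin 3) : EuclideanSpace ℝ (Fin 3) →L[ℝ] ℝ) y :=
      ((EuclideanSpace.proj (2 : Fin 3) : EuclideanSpace ℝ (Fin 3) →L[ℝ] ℝ).hasFDerivAt).sub_const (y₀ 2)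
    rw [hH1, h.fderiv]; rfl
  have hG0d : ∀ y w, fderiv ℝ G0 y w = fderiv ℝ ψ y w := by
    intro y w; rw [hG0, fderiv_sub_const]
  have hGd : ∀ y w, fderiv ℝ G y w = ![fderiv ℝ ψ y w, w 2] := by
    intro y w
    rw [hG, fderiv_pi (Fin.forall_fin_two.2 ⟨(hG0c.differentiable one_ne_zero) y, (hH1c.differentiable one_ne_zero) y⟩)]
    ext i
    fin_cases i
    · simp [hGc, hG0d]
    · simp [hGc, hH1d]
  -- near the small disc, `H` agrees with `G`
  have hHG : ∀ y : EuclideanSpace ℝ (Fin 3), dist y y₀ < 2 * r₁ → H =ᶠ[𝓝 y] G := by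
    intro y hy
    have h1 : (ρ' : EuclideanSpace ℝ (Fin 3) → ℝ) =ᶠ[𝓝 y] 1 :=
      ρ'.eventuallyEq_one_of_mem_ball (mem_ball.2 hy)
    filter_upwards [h1] with y' hy'
    funext i
    fin_cases i
    · show H0 y' = G0 y'
      simp only [hH0, hG0, hy', Pi.one_apply, one_mul, sub_self, add_zero]
    · rfl
  have hfdH : ∀ y : EuclideanSpace ℝ (Fin 3), dist y y₀ < 2 * r₁ → ∀ w,
      fderiv ℝ H y w = ![fderiv ℝ ψ y w, w 2] := by
    intro y hy w
    rw [(hHG y hy).fderiv_eq, hGd]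
  -- (ii) `dH(V) = 0` everywhere
  have hHV : ∀ y, fderiv ℝ H y (V y) = 0 := by
    intro y
    by_cases hy : dist y y₀ < 2 * r₁
    · rw [hfdH y hy]
      have h1 : fderiv ℝ ψ y (V y) = 0 := by
        rw [hV]; dsimp only; rw [map_smul, fderiv_stream_apply_self hX2 hψ0 hψ1, smul_zero]
      have h2 : V y 2 = 0 := by simp [hV, hX2]
      rw [h1, h2]
      ext i; fin_cases i <;> rfl
    · have h0 : V y = 0 := by
        rw [hV]; dsimp only; rw [hρ_zero y (not_lt.1 hy), zero_smul]
      rw [h0, map_zero]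
  -- the zero set of `H`
  have hzero : ∀ y, H y = 0 → y 2 = y₀ 2 ∧ dist y y₀ ≤ r₁ ∧ ψ y = c := by
    intro y hHy
    have h0 : H0 y = 0 := by rw [← hHapp0]; exact congrFun hHy 0
    have h1 : H1 y = 0 := by rw [← hHapp1]; exact congrFun hHy 1
    have hy2 : y 2 = y₀ 2 := sub_eq_zero.1 h1
    have hyd : dist y y₀ ≤ r₁ := by
      by_contra hgt
      push Not at hgt
      by_cases hfar : 3 * r₁ ≤ dist y y₀
      · have : H0 y = 1 := by simp only [hH0, hρ'_zero y hfar, zero_mul, sub_zero, zero_add]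
        rw [this] at h0; exact one_ne_zero h0
      · push Not at hfar
        have hyA : y ∈ A := ⟨hy2, hgt.le, by linarith⟩
        have hpos : 0 < ψ y - c := by linarith [hAge y hyA, hc.2]
        have hρ0 : 0 ≤ (ρ' : EuclideanSpace ℝ (Fin 3) → ℝ) y := ρ'.nonneg
        have hρ1 : (ρ' : EuclideanSpace ℝ (Fin 3) → ℝ) y ≤ 1 := ρ'.le_one
        have hval : (ρ' : EuclideanSpace ℝ (Fin 3) → ℝ) y * (ψ y - c) + (1 - ρ' y) = 0 := h0
        nlinarith [mul_nonneg hρ0 hpos.le]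
    refine ⟨hy2, hyd, ?_⟩
    have : H0 y = ψ y - c := by
      simp only [hH0, hρ'_one y (by linarith), one_mul, sub_self, add_zero]
    rw [this] at h0; exact sub_eq_zero.1 h0
  -- (iii) `V ≠ 0` on the zero set
  have hXne : ∀ y, H y = 0 → X y ≠ 0 := by
    intro y hHy hX0
    obtain ⟨hy2, hyd, hyψ⟩ := hzero y hHy
    exact hreg y hy2 (by linarith) hyψ ⟨by rw [hX0]; rfl, by rw [hX0]; rfl⟩
  have hVX : ∀ y, H y = 0 → V y = X y := by
    intro y hHy
    obtain ⟨-, hyd, -⟩ := hzero y hHy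
    rw [hV]; dsimp only; rw [hρ_one y hyd, one_smul]
  have hne : ∀ y, H y = 0 → V y ≠ 0 := fun y hHy => by rw [hVX y hHy]; exact hXne y hHy
  -- (iv) `dH` onto on the zero set
  have hsurj : ∀ y, H y = 0 → Function.Surjective (fderiv ℝ H y) := by
    intro y hHy g
    obtain ⟨hy2, hyd, hyψ⟩ := hzero y hHy
    have hy2r : dist y y₀ < 2 * r₁ := by linarith
    set u₀ : ℝ := fderiv ℝ ψ y e0 with hu₀
    set u₁ : ℝ := fderiv ℝ ψ y e1 with hu₁
    set u₂ : ℝ := fderiv ℝ ψ y e2 with hu₂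
    have hN : 0 < u₀ ^ 2 + u₁ ^ 2 := by
      have hXy := hXne y hHy
      have h : u₀ ≠ 0 ∨ u₁ ≠ 0 := by
        by_contra hcon
        push Not at hcon
        apply hXy
        ext i
        fin_cases i
        · have := hcon.2; rw [hu₁, he1, hψ1] at this; simpa using this
        · have := hcon.1; rw [hu₀, he0, hψ0] at this; simpa using this
        · simpa using hX2 y
      rcases h with h | h
      · have := sq_pos_of_ne_zero h; positivity
      · have := sq_pos_of_ne_zero h; positivity
    set lam : ℝ := (g 0 - g 1 * u₂) / (u₀ ^ 2 + u₁ ^ 2) with hlam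
    refine ⟨lam • (u₀ • e0 + u₁ • e1) + g 1 • e2, ?_⟩
    rw [hfdH y hy2r]
    have hlin : fderiv ℝ ψ y (lam • (u₀ • e0 + u₁ • e1) + g 1 • e2) =
        lam * (u₀ * u₀ + u₁ * u₁) + g 1 * u₂ := by
      rw [map_add, map_smul, map_add, map_smul, map_smul, map_smul, ← hu₀, ← hu₁, ← hu₂]
      simp only [smul_eq_mul]
    have hval : lam * (u₀ * u₀ + u₁ * u₁) + g 1 * u₂ = g 0 := by
      have hN' : u₀ * u₀ + u₁ * u₁ = u₀ ^ 2 + u₁ ^ 2 := by ring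
      rw [hN', hlam, div_mul_cancel₀ _ hN.ne']
      ring
    have hcoord : (lam • (u₀ • e0 + u₁ • e1) + g 1 • e2) 2 = g 1 := by
      rw [he0, he1, he2]
      simp [PiLp.add_apply, PiLp.smul_apply]
    rw [hlin, hval, hcoord]
    ext i; fin_cases i <;> rfl
  -- boundedness of the zero set and membership of `p`
  have hbdd : ∀ y, H y = 0 → ‖y‖ ≤ ‖y₀‖ + r₁ := by
    intro y hHy
    obtain ⟨-, hyd, -⟩ := hzero y hHy
    rw [dist_eq_norm] at hyd
    calc ‖y‖ = ‖(y - y₀) + y₀‖ := by rw [sub_add_cancel]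
      _ ≤ ‖y - y₀‖ + ‖y₀‖ := norm_add_le _ _
      _ ≤ ‖y₀‖ + r₁ := by linarith
  have hHp : H p = 0 := by
    funext i
    fin_cases i
    · show H0 p = 0
      simp only [hH0, hρ'_one p (by linarith), one_mul, sub_self, add_zero, hpψ]
    · show H1 p = 0
      simp only [hH1, hp2, sub_self]
  -- (f) the periodic orbit
  obtain ⟨γ, ℓ, hℓ, hγ, hγper, hγ0, hγH⟩ :=
    exists_periodic_orbit_of_regular_level hHcd hVcd hHV hne hsurj hbdd hHp
  refine ⟨γ, ℓ, hℓ, fun θ => ?_, hγper, ?_⟩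
  · have h := hγ θ
    rwa [hVX _ (hγH θ)] at h
  · rw [hγ0]; exact hXne p hHp

end Summit.NavierStokesRegularity.NavierStokesRegularity.Theorems.LoopPeriodRatchetNoPlanarExtremumCore

end
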